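import Summits.ABC.ABC.Theorems.TwoSixPencilPencilBoundMember
import Summits.ABC.ABC.Theorems.StewartYu2001ThmTwoHolds
import HarnessLib

/-!
# The pencil engine, II: the min-member step and the general pencil theorem (any `k ≥ 3`)

`Summits/ABC/ABC/Theorems/TwoSixPencilPencilBoundEngine.lean` — engine file for the crux
`Summit.ABC.ABC.Theses.TwoSixPencil.PencilBound` (stmt-ABC-24782) and its `k = 4` instance
`Summit.ABC.ABC.Theses.RationalCuspPencil.PencilFourBound` (stmt-ABC-24549); the closers are the
files `TwoSixPencilPencilBound.lean` / `RationalCuspPencilPencilFourBound.lean`, which only unfold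
the route decls onto `pencil_log_height_le_rad_rpow` below.

* `exists_min_member_pow_le` — for pairwise non-proportional forms `Lᵢ = aᵢu + bᵢw` (`i < k`),
  coprime `u, w`, `∏ Lᵢ ≠ 0`: some member has `P(Lᵢ)^k ≤ Dₙ^k · rad(∏ Lᵢ)`,
  `Dₙ = 1 + Σᵢⱼ |aᵢbⱼ − aⱼbᵢ|` (a prime that is the largest prime factor of two members divides
  their resultant; otherwise the `k` largest prime factors are distinct primes of the product);
* `log_height_le_of_thm2` — Theorem 2 ⇒ the general pencil bound
  `log max(|u|,|w|) ≤ C(ε, forms) · rad(∏ᵢ Lᵢ(u,w))^{1/k+ε}` (per-member bound of file I for every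
  member, then the min-member step);
* `pencil_log_height_le_rad_rpow` — the same UNCONDITIONALLY, by the tree's
  `Summit.ABC.ABC.Theorems.stewartYu2001_thm2_holds`.

HONESTY: a corollary of a PROVED theorem of the tree (Stewart–Yu 2001 Thm 2); exponent `1/k` is
charged to the radical of `k` members of one binary pencil — a locus statement, NOT abc, NOT A-PS
(polynomial Szpiro), NOT rung A1′; `k = 3` is the tree's ε-column `1/3`
(`StewartYu2001.epsShapeBound_third_of_thm2`).
References: [StewartYu2001] Thm 2 and the remark after it; [Sheppard2016] §2.4.
-/

set_option linter.dupNamespace false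

noncomputable section

open UniqueFactorizationMonoid Finset
open Literature.NumberTheory.DiophantineGeometry Literature.Barriers.ABC
open Literature.NumberTheory.DiophantineGeometry.StewartYu2001

namespace Summit.ABC.ABC.Theorems.PencilBoundLine

/-! ### The min-member step: `(min P(Lᵢ))^k ≤ D^k · rad(∏ Lᵢ)` -/

/-- **Min-member bound.** For `k ≥ 1` pairwise non-proportional integral forms `Lᵢ = aᵢu + bᵢw`,
coprime `u, w` with `∏ Lᵢ(u,w) ≠ 0`, some member `L_{i₀}` has
`P(L_{i₀})^k ≤ Dₙ^k · rad(∏ Lᵢ(u,w))` with `Dₙ = 1 + Σᵢⱼ |aᵢbⱼ − aⱼbᵢ|`: either the least `P(Lᵢ)`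
is `1`, or two members share their largest prime `p`, which then divides the resultant
`aᵢbⱼ − aⱼbᵢ ≠ 0` (so `p ≤ Dₙ`), or the `P(Lᵢ)` are `k` distinct primes of `∏ Lᵢ`, whose product
is at most the radical (the `k`-member form of `StewartYu2001.pmin_pow_three_le_rad`).
[cite: StewartYu2001, remark after Theorem 2] -/
theorem exists_min_member_pow_le {k : ℕ} (hk : 1 ≤ k) (a b : Fin k → ℤ)
    (hab : ∀ i j, i ≠ j → a i * b j ≠ a j * b i) {u w : ℤ} (huw : IsCoprime u w)
    (h0 : ∏ i, (a i * u + b i * w) ≠ 0) :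
    ∃ i₀ : Fin k, largestPrimeFactor (a i₀ * u + b i₀ * w).natAbs ^ k ≤
      (1 + ∑ i, ∑ j, (a i * b j - a j * b i).natAbs) ^ k *
        radical (∏ i, (a i * u + b i * w)).natAbs := by
  classical
  set P : Fin k → ℕ := fun i => largestPrimeFactor (a i * u + b i * w).natAbs with hPdef
  set Dn : ℕ := 1 + ∑ i, ∑ j, (a i * b j - a j * b i).natAbs with hDn
  set M : ℕ := (∏ i, (a i * u + b i * w)).natAbs with hM
  have hM0 : M ≠ 0 := Int.natAbs_ne_zero.mpr h0
  have hne : (Finset.univ : Finset (Fin k)).Nonempty := ⟨⟨0, hk⟩, Finset.mem_univ _⟩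
  obtain ⟨i₀, -, hmin⟩ := Finset.exists_min_image Finset.univ P hne
  refine ⟨i₀, ?_⟩
  change P i₀ ^ k ≤ Dn ^ k * radical M
  have hDn1 : 1 ≤ Dn := by rw [hDn]; exact Nat.le_add_right _ _
  have hR0 : 0 < radical M := Nat.radical_pos M
  have hDk : 1 ≤ Dn ^ k * radical M := Nat.mul_pos (Nat.pow_pos hDn1) hR0
  by_cases h1 : P i₀ = 1
  · rw [h1, one_pow]; exact hDk
  -- every `P(Lᵢ)` is a prime dividing `Lᵢ`
  have hprime : ∀ i, (P i).Prime ∧ P i ∣ (a i * u + b i * w).natAbs := by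
    intro i
    rcases largestPrimeFactor_eq_one_or_prime (a i * u + b i * w).natAbs with h | h
    · exfalso
      have hle : P i₀ ≤ P i := hmin i (Finset.mem_univ i)
      have hPi : P i = 1 := h
      rw [hPi] at hle
      exact h1 (le_antisymm hle (one_le_largestPrimeFactor _))
    · exact h
  by_cases hinj : ∃ i j, i ≠ j ∧ P i = P j
  · -- two members share their top prime `p`: `p ∣ aᵢbⱼ − aⱼbᵢ`
    obtain ⟨i, j, hij, hPij⟩ := hinj
    have hpi : (P i : ℤ) ∣ a i * u + b i * w := Int.natCast_dvd.mpr (hprime i).2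
    have hpj : (P i : ℤ) ∣ a j * u + b j * w := by rw [hPij]; exact Int.natCast_dvd.mpr (hprime j).2
    obtain ⟨s, t, hst⟩ := huw
    have hD : a i * b j - a j * b i =
        (s * b j - t * a j) * (a i * u + b i * w) + (t * a i - s * b i) * (a j * u + b j * w) := by
      linear_combination (-(a i * b j - a j * b i)) * hst
    have hpD : (P i : ℤ) ∣ a i * b j - a j * b i := by
      rw [hD]; exact dvd_add (dvd_mul_of_dvd_right hpi _) (dvd_mul_of_dvd_right hpj _)
    have hDij0 : a i * b j - a j * b i ≠ 0 := sub_ne_zero.mpr (hab i j hij)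
    have hple : P i ≤ (a i * b j - a j * b i).natAbs :=
      Nat.le_of_dvd (Int.natAbs_pos.mpr hDij0) (Int.natCast_dvd.mp hpD)
    have hleDn : (a i * b j - a j * b i).natAbs ≤ Dn := by
      have h1 : (a i * b j - a j * b i).natAbs ≤ ∑ j', (a i * b j' - a j' * b i).natAbs :=
        Finset.single_le_sum (f := fun j' => (a i * b j' - a j' * b i).natAbs)
          (fun _ _ => Nat.zero_le _) (Finset.mem_univ j)
      have h2 : ∑ j', (a i * b j' - a j' * b i).natAbs ≤
          ∑ i', ∑ j', (a i' * b j' - a j' * b i').natAbs :=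
        Finset.single_le_sum (f := fun i' => ∑ j', (a i' * b j' - a j' * b i').natAbs)
          (fun _ _ => Nat.zero_le _) (Finset.mem_univ i)
      rw [hDn]
      exact (h1.trans h2).trans (Nat.le_add_left _ _)
    calc P i₀ ^ k ≤ P i ^ k := Nat.pow_le_pow_left (hmin i (Finset.mem_univ i)) k
      _ ≤ Dn ^ k := Nat.pow_le_pow_left (hple.trans hleDn) k
      _ ≤ Dn ^ k * radical M := Nat.le_mul_of_pos_right _ hR0
  · -- the `P(Lᵢ)` are `k` distinct primes of `∏ Lᵢ`
    push Not at hinj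
    have hinjOn : Set.InjOn P ↑(Finset.univ : Finset (Fin k)) :=
      fun i _ j _ h => by_contra fun hij => hinj i j hij h
    have hsub : Finset.image P Finset.univ ⊆ M.primeFactors := by
      intro p hp
      obtain ⟨i, -, rfl⟩ := Finset.mem_image.mp hp
      refine Nat.mem_primeFactors.mpr ⟨(hprime i).1, (hprime i).2.trans ?_, hM0⟩
      rw [hM]
      exact Int.natAbs_dvd_natAbs.mpr (Finset.dvd_prod_of_mem _ (Finset.mem_univ i))
    calc P i₀ ^ k = P i₀ ^ (Finset.univ : Finset (Fin k)).card := by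
          rw [Finset.card_univ, Fintype.card_fin]
      _ ≤ ∏ i, P i := Finset.pow_card_le_prod Finset.univ P (P i₀) fun i _ => hmin i (Finset.mem_univ i)
      _ = ∏ p ∈ Finset.image P Finset.univ, p := by rw [Finset.prod_image hinjOn]
      _ ≤ ∏ p ∈ M.primeFactors, p :=
          Finset.prod_le_prod_of_subset_of_one_le' hsub fun p hp _ =>
            (Nat.prime_of_mem_primeFactors hp).one_lt.le
      _ = radical M := Nat.radical_eq_prod_primeFactors.symm
      _ ≤ Dn ^ k * radical M := Nat.le_mul_of_pos_left _ (Nat.pow_pos hDn1)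

/-- In `Fin k` with `k ≥ 3` every index has two further indices, all three distinct. [folklore] -/
theorem exists_two_others {k : ℕ} (hk : 3 ≤ k) (i : Fin k) :
    ∃ j l : Fin k, i ≠ j ∧ j ≠ l ∧ i ≠ l := by
  by_cases h0 : (i : ℕ) = 0
  · refine ⟨⟨1, by omega⟩, ⟨2, by omega⟩, ?_, ?_, ?_⟩ <;>
      simp [Fin.ext_iff, h0]
  by_cases h1 : (i : ℕ) = 1
  · refine ⟨⟨0, by omega⟩, ⟨2, by omega⟩, ?_, ?_, ?_⟩ <;>
      simp [Fin.ext_iff, h1]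
  · refine ⟨⟨0, by omega⟩, ⟨1, by omega⟩, ?_, ?_, ?_⟩ <;>
      simp [Fin.ext_iff, h0, h1]

/-! ### The general pencil theorem -/

/-- **The pencil engine (general `k`), conditional form.** If Stewart–Yu's Theorem 2 holds, then
for every `k ≥ 3`, all pairwise non-proportional integral linear forms `Lᵢ = aᵢu + bᵢw`
(`i < k`) and every `ε > 0` there is `C` with
`log max(|u|,|w|) ≤ C · rad(∏ᵢ Lᵢ(u,w))^{1/k+ε}` for all coprime integers `u, w` with
`∏ᵢ Lᵢ(u,w) ≠ 0`. Proof: `member_bound` for every member (with the sub-pencil through two other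
members and `N = ∏ Lᵢ`) gives `log H ≤ K · P(Lᵢ) · R^ε` for all `i`; `exists_min_member_pow_le`
gives a member with `P(Lᵢ) ≤ Dₙ · R^{1/k}`. [cite: StewartYu2001, Theorem 2 and the remark after it] -/
theorem log_height_le_of_thm2 (hSY : stewartYu2001_thm2) (k : ℕ) (a b : Fin k → ℤ) (hk : 3 ≤ k)
    (hab : ∀ i j, i ≠ j → a i * b j ≠ a j * b i) (ε : ℝ) (hε : 0 < ε) :
    ∃ C : ℝ, ∀ u w : ℤ, IsCoprime u w → (∏ i, (a i * u + b i * w)) ≠ 0 →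
      Real.log ((max |u| |w| : ℤ) : ℝ) ≤
        C * (((radical (∏ i, (a i * u + b i * w))).natAbs : ℕ) : ℝ) ^ (1 / (k : ℝ) + ε) := by
  classical
  have h3 : ∀ i : Fin k, ∃ j l : Fin k, i ≠ j ∧ j ≠ l ∧ i ≠ l := fun i => exists_two_others hk i
  choose j₁ j₂ hj₁ hj₁₂ hj₂ using h3
  have hmem : ∀ i : Fin k, ∃ K : ℝ, 0 ≤ K ∧ ∀ u w N : ℤ, IsCoprime u w → N ≠ 0 →
      (a i * u + b i * w) * (a (j₁ i) * u + b (j₁ i) * w) * (a (j₂ i) * u + b (j₂ i) * w) ∣ N →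
      Real.log ((max |u| |w| : ℤ) : ℝ) ≤
        K * largestPrimeFactor (a i * u + b i * w).natAbs * (((radical N).natAbs : ℕ) : ℝ) ^ ε :=
    fun i => member_bound hSY hε (hab i (j₁ i) (hj₁ i)) (hab (j₁ i) (j₂ i) (hj₁₂ i))
      (hab i (j₂ i) (hj₂ i))
  choose K hK0 hK using hmem
  set Dn : ℕ := 1 + ∑ i, ∑ j, (a i * b j - a j * b i).natAbs with hDn
  have hKsum : 0 ≤ ∑ i, K i := Finset.sum_nonneg fun i _ => hK0 i
  refine ⟨(∑ i, K i) * Dn, fun u w huw h0 => ?_⟩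
  set N : ℤ := ∏ i, (a i * u + b i * w) with hN
  set RN : ℝ := (((radical N).natAbs : ℕ) : ℝ) with hRN
  have hRN0 : 0 < RN := by
    rw [hRN]; exact_mod_cast Nat.pos_of_ne_zero (Int.natAbs_ne_zero.mpr radical_ne_zero)
  -- every member
  have hper : ∀ i, Real.log ((max |u| |w| : ℤ) : ℝ) ≤
      (∑ i, K i) * largestPrimeFactor (a i * u + b i * w).natAbs * RN ^ ε := by
    intro i
    have hdvd : (a i * u + b i * w) * (a (j₁ i) * u + b (j₁ i) * w) *
        (a (j₂ i) * u + b (j₂ i) * w) ∣ N := by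
      have h1 : ∏ m ∈ ({i, j₁ i, j₂ i} : Finset (Fin k)), (a m * u + b m * w) =
          (a i * u + b i * w) * (a (j₁ i) * u + b (j₁ i) * w) * (a (j₂ i) * u + b (j₂ i) * w) := by
        rw [Finset.prod_insert (by simp [hj₁ i, hj₂ i]), Finset.prod_pair (hj₁₂ i), mul_assoc]
      rw [← h1, hN]
      exact Finset.prod_dvd_prod_of_subset _ _ _ (Finset.subset_univ _)
    calc Real.log ((max |u| |w| : ℤ) : ℝ)
        ≤ K i * largestPrimeFactor (a i * u + b i * w).natAbs * RN ^ ε := hK i u w N huw h0 hdvd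
      _ ≤ (∑ i, K i) * largestPrimeFactor (a i * u + b i * w).natAbs * RN ^ ε := by
          gcongr
          exact Finset.single_le_sum (fun j _ => hK0 j) (Finset.mem_univ i)
  -- the min member
  obtain ⟨i₀, hi₀⟩ := exists_min_member_pow_le (by omega) a b hab huw h0
  have hk0 : (k : ℝ) ≠ 0 := by positivity
  have hPreal : (largestPrimeFactor (a i₀ * u + b i₀ * w).natAbs : ℝ) ≤ Dn * RN ^ (1 / (k : ℝ)) := by
    have h5 : (radical N).natAbs = radical N.natAbs := by
      rw [← Int.radical_natAbs_eq_radical, Int.natAbs_natCast]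
    have h1 : ((largestPrimeFactor (a i₀ * u + b i₀ * w).natAbs : ℝ)) ^ (k : ℕ) ≤
        (Dn : ℝ) ^ (k : ℕ) * RN := by
      rw [hRN, h5, hN, hDn]; exact_mod_cast hi₀
    have hP0 : (0 : ℝ) ≤ largestPrimeFactor (a i₀ * u + b i₀ * w).natAbs := Nat.cast_nonneg _
    have hDn0 : (0 : ℝ) ≤ Dn := Nat.cast_nonneg _
    calc (largestPrimeFactor (a i₀ * u + b i₀ * w).natAbs : ℝ)
        = (((largestPrimeFactor (a i₀ * u + b i₀ * w).natAbs : ℝ)) ^ (k : ℕ)) ^ (1 / (k : ℝ)) := by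
          rw [← Real.rpow_natCast, ← Real.rpow_mul hP0, mul_one_div_cancel hk0, Real.rpow_one]
      _ ≤ ((Dn : ℝ) ^ (k : ℕ) * RN) ^ (1 / (k : ℝ)) :=
          Real.rpow_le_rpow (by positivity) h1 (by positivity)
      _ = Dn * RN ^ (1 / (k : ℝ)) := by
          rw [Real.mul_rpow (by positivity) hRN0.le, ← Real.rpow_natCast, ← Real.rpow_mul hDn0,
            mul_one_div_cancel hk0, Real.rpow_one]
  calc Real.log ((max |u| |w| : ℤ) : ℝ)
      ≤ (∑ i, K i) * largestPrimeFactor (a i₀ * u + b i₀ * w).natAbs * RN ^ ε := hper i₀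
    _ ≤ (∑ i, K i) * (Dn * RN ^ (1 / (k : ℝ))) * RN ^ ε := by gcongr
    _ = (∑ i, K i) * Dn * (RN ^ (1 / (k : ℝ)) * RN ^ ε) := by ring
    _ = (∑ i, K i) * Dn * RN ^ (1 / (k : ℝ) + ε) := by rw [← Real.rpow_add hRN0]

end Summit.ABC.ABC.Theorems.PencilBoundLine

namespace Summit.ABC.ABC.Theorems

open PencilBoundLine

/-- **The pencil engine, general `k` (unconditional).** For every `k ≥ 3`, all pairwise
non-proportional integral linear forms `Lᵢ = aᵢu + bᵢw` (`aᵢbⱼ ≠ aⱼbᵢ` for `i ≠ j`) and every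
`ε > 0` there is `C` (depending on `ε` and the forms) with
`log max(|u|,|w|) ≤ C · rad(∏ᵢ Lᵢ(u,w))^{1/k+ε}` for all coprime integers `u, w` with
`∏ᵢ Lᵢ(u,w) ≠ 0` — Stewart–Yu 2001 Theorem 2 (`stewartYu2001_thm2_holds`) on the sub-pencil
through the member with the least largest prime factor. This is verbatim the body of the route
decl `Summit.ABC.ABC.Theses.TwoSixPencil.PencilBound`; stated here without the route import so that
other classes (ℤ/8, ℤ/10, ℤ/2×ℤ/4, ℤ/2×ℤ/8, ℤ/12, ℤ/2×ℤ/6, …) cite it BY NAME. NOT abc (the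
exponent `1/k` is charged to the radical of `k` members of ONE binary pencil), NOT A-PS, NOT A1′.
[cite: StewartYu2001, Theorem 2 and the remark after it] -/
theorem pencil_log_height_le_rad_rpow (k : ℕ) (a b : Fin k → ℤ) (hk : 3 ≤ k)
    (hab : ∀ i j, i ≠ j → a i * b j ≠ a j * b i) (ε : ℝ) (hε : 0 < ε) :
    ∃ C : ℝ, ∀ u w : ℤ, IsCoprime u w → (∏ i, (a i * u + b i * w)) ≠ 0 →
      Real.log ((max |u| |w| : ℤ) : ℝ) ≤
        C * (((radical (∏ i, (a i * u + b i * w))).natAbs : ℕ) : ℝ) ^ (1 / (k : ℝ) + ε) :=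
  log_height_le_of_thm2 stewartYu2001_thm2_holds k a b hk hab ε hε

end Summit.ABC.ABC.Theorems

end
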